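import Summits.HodgeConjecture.HodgeConjecture.Theorems.F0P2oStubDictTorusChar   -- ★ K2 closer (`semilocalComponent_mu_quotConj`) and its cone: `cmXiTorusChar`, `torusCharPair`, `halfModulusChar`, …
import Literature.NumberTheory.Automorphic.UnitaryGroupLocalFactors              -- ★ `continuous_conjLocal`
import Literature.NumberTheory.Rogawski1990.U3PrincipalSeriesWeylConjugate        -- ★ letter K1w (typ-T7a): NAMED FACT `cmPrincipalSeries_isConstituentOf_weylConj`
import HarnessLib

/-!
# Crux `H413`, programme P2, pay-down line `F0_P2GR91NJacquet`, K1 sub-line — the CONSUMER ALGEBRA of stub K1w «Weyl symmetry»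

The Weyl flip `χ ↦ wχ`, `(wχ)(d(α,β,ᾱ⁻¹)) = χ(d(ᾱ⁻¹,β,α))`, of the character `χθ^w = cmXiTorusChar L v (μ_v·‖·‖⁻¹) ψθ⁻¹ ψθ` of the
diagonal torus of `U(Φ₃)(L⁺_v)` IS `χθ = cmXiTorusChar L v μ_v ψθ⁻¹ ψθ` when `μ` is conjugate-symplectic: in the ★ `torusCharPair`
coordinates (`χ = (χ₁, χ₂)`, `w(χ₁, χ₂) = (χ̄₁⁻¹, χ₂)`, [Rogawski1990, §12.2 p. 174]) this is the identity
`((χ₁θʷ) ∘ σ)⁻¹ = χ₁θ` of characters of `(∏_{w∣v} L_w)ˣ`, which rests on three ★-grade facts proved here: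
(A) the module `‖·‖` (Mathlib `distribHaarChar`, ★ `unitModulusChar`/`halfModulusChar`) is invariant under the continuous ring
involution `σ = c ⊗ 1` (★ `conjLocal`); (B) `(a/ā) ∘ σ = (a/ā)⁻¹` (★ `quotConj`); (C) `μ_v ∘ σ = μ_v⁻¹` for the semilocal
component of a conjugate-symplectic `toHeckeCharacter μ` (★ `F0P2oStubDictTorusChar.semilocalComponent_mu_quotConj`).
HC_CM is proved only modulo the printed citations until rung 0 closes; this file is pure character algebra (no letter is used or proved).

## References
* [Rogawski1990] J. D. Rogawski, *Automorphic Representations of Unitary Groups in Three Variables*, Ann. of Math. Stud. 123 (1990),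
  §12.1 p. 172, §12.2 (2) p. 174 («`i_G(χ)` and `i_G(wχ)` have the same sets of constituents … `w(χ₁, χ₂) = (χ̄₁⁻¹, χ₂)`»).
* [BernsteinZelevinsky1977] I. N. Bernstein, A. V. Zelevinsky, Ann. Sci. ÉNS 10 (1977), Thm. 2.9.
-/

set_option autoImplicit false
-- the mandated namespace has the single-problem summit's repeated segment (`HodgeConjecture.HodgeConjecture`)
set_option linter.dupNamespace false

noncomputable section

open NumberField IsDedekindDomain MeasureTheory
open scoped NNReal Pointwise

open Literature.NumberTheory Literature.NumberTheory.Automorphic Literature.NumberTheory.Automorphic.UnitaryGroup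
open Literature.NumberTheory.Automorphic.IdeleClassGroup
open Literature.NumberTheory.Automorphic.Liu2021 Literature.NumberTheory.Automorphic.Liu2021.Def411WeilCarriers
open Literature.NumberTheory.GaloisRepresentations
open Literature.NumberTheory.Rogawski1990
open Literature.NumberTheory.GelbartRogawski1991
open scoped Matrix

namespace Summit.HodgeConjecture.HodgeConjecture.Cruxes.H413.F0P2oK1wOfWeylConj

/-! ## §1 (A) The module `‖·‖` of a locally compact ring is invariant under a continuous ring involution -/

/-- **`‖σ(a)‖ = ‖a‖` for a continuous ring involution `σ`** of a locally compact (Hausdorff) topological ring `R`: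
Mathlib's `distribHaarChar R` (the factor by which `x ↦ a x` scales additive Haar measure) is unchanged under `a ↦ σ(a)`,
because `σ` transports an additive Haar measure `μ` to the additive Haar measure `σ_* μ` and `σ⁻¹(σ(a)·S) = a·σ⁻¹(S)`.
[cite: Folland1999, §11.1 (Thm. 11.9, uniqueness of Haar measure)] -/
theorem distribHaarChar_units_map_of_involutive {R : Type*} [CommRing R] [TopologicalSpace R] [IsTopologicalRing R]
    [LocallyCompactSpace R] [T2Space R] (σ : R →+* R) (hσc : Continuous σ) (hσ : ∀ x, σ (σ x) = x) (a : Rˣ) :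
    distribHaarChar R (Units.map (σ : R →* R) a) = distribHaarChar R a := by
  borelize R
  -- `σ` as a homeomorphism and as a continuous additive equivalence
  let e : R ≃ₜ R :=
    { toFun := σ, invFun := σ, left_inv := hσ, right_inv := hσ, continuous_toFun := hσc, continuous_invFun := hσc }
  let ea : R ≃+ R := { toFun := σ, invFun := σ, left_inv := hσ, right_inv := hσ, map_add' := map_add σ }
  obtain ⟨K⟩ := (inferInstance : Nonempty (TopologicalSpace.PositiveCompacts R))
  set μ : Measure R := Measure.addHaarMeasure K with hμ
  haveI : (Measure.map σ μ).IsAddHaarMeasure := ea.isAddHaarMeasure_map μ hσc hσc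
  haveI : (Measure.map σ μ).Regular := Measure.Regular.map e
  have hmap : ∀ s : Set R, (Measure.map σ μ) s = μ (σ ⁻¹' s) := fun s =>
    MeasurableEquiv.map_apply e.toMeasurableEquiv s
  have hK0 : (Measure.map σ μ) (K : Set R) ≠ 0 :=
    (Measure.measure_pos_of_nonempty_interior _ K.interior_nonempty).ne'
  have hKtop : (Measure.map σ μ) (K : Set R) ≠ ⊤ := K.isCompact.measure_lt_top.ne
  refine distribHaarChar_eq_of_measure_smul_eq_mul (μ := Measure.map σ μ) hK0 hKtop ?_
  -- `σ⁻¹(σ(a) · K) = a · σ⁻¹(K)`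
  have hset : σ ⁻¹' ((Units.map (σ : R →* R) a) • (K : Set R)) = a • (σ ⁻¹' (K : Set R)) := by
    ext x
    simp only [Set.mem_preimage, Set.mem_smul_set, Units.smul_def, Units.coe_map, MonoidHom.coe_coe, smul_eq_mul]
    constructor
    · rintro ⟨y, hy, hyx⟩
      refine ⟨σ y, by rwa [hσ], ?_⟩
      rw [← hσ x, ← hyx, map_mul, hσ]
    · rintro ⟨z, hz, rfl⟩
      exact ⟨σ z, hz, by rw [map_mul]⟩
  rw [hmap, hmap, hset]
  exact (distribHaarChar_mul μ a _).symm

/-- The same for the tree's `unitModulusChar R = ‖·‖` (★ `UnitaryGroup.unitModulusChar` IS `distribHaarChar R`).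
[cite: Rogawski1990, §12.2 p. 173] -/
theorem unitModulusChar_units_map_of_involutive {R : Type*} [CommRing R] [TopologicalSpace R] [IsTopologicalRing R]
    [LocallyCompactSpace R] [T2Space R] (σ : R →+* R) (hσc : Continuous σ) (hσ : ∀ x, σ (σ x) = x) (a : Rˣ) :
    unitModulusChar R (Units.map (σ : R →* R) a) = unitModulusChar R a :=
  distribHaarChar_units_map_of_involutive σ hσc hσ a

/-- And for `‖·‖^{1/2}` (★ `halfModulusChar`, built from `unitModulusChar` through `√` and `ℝ≥0 → ℝ → ℂ`).
[cite: Rogawski1990, §12.2 p. 173] -/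
theorem halfModulusChar_units_map_of_involutive {R : Type*} [CommRing R] [TopologicalSpace R] [IsTopologicalRing R]
    [LocallyCompactSpace R] [T2Space R] (σ : R →+* R) (hσc : Continuous σ) (hσ : ∀ x, σ (σ x) = x) (a : Rˣ) :
    halfModulusChar R (Units.map (σ : R →* R) a) = halfModulusChar R a := by
  ext
  rw [coe_halfModulusChar_apply, coe_halfModulusChar_apply, unitModulusChar_units_map_of_involutive σ hσc hσ a]

/-! ## §2 (B) `a/ā` under `σ` -/

/-- **`(σa)/σ(σa) = (a/σ(a))⁻¹`**: the quotient-by-conjugate map ★ `quotConj σ` (`a ↦ a·σ(a)⁻¹ ∈ E¹`) of an involution `σ`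
inverts under `a ↦ σ(a)`. [cite: Rogawski1990, §12.1 p. 172] -/
theorem quotConj_units_map {R : Type*} [CommRing R] (σ : R →+* R) (hσ : ∀ x, σ (σ x) = x) (a : Rˣ) :
    quotConj σ hσ (Units.map (σ : R →* R) a) = (quotConj σ hσ a)⁻¹ := by
  apply Subtype.ext
  have h2 : Units.map (σ : R →* R) (Units.map (σ : R →* R) a) = a := Units.ext (hσ a)
  rw [Subgroup.coe_inv, coe_quotConj, coe_quotConj, h2, mul_inv_rev, inv_inv]

/-! ## §3 (C) a conjugate-symplectic `μ` semi-locally: `μ_v(σ x) = μ_v(x)⁻¹` -/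

/-- **`μ_v ∘ (c ⊗ 1) = μ_v⁻¹` on `(∏_{w∣v} L_w)ˣ`** for the semilocal component `μ_v` of `toHeckeCharacter μ`, `μ` conjugate-symplectic
(`μ^c = μ⁻¹`): immediate from ★ `F0P2oStubDictTorusChar.semilocalComponent_mu_quotConj` (`μ_v(x/x̄) = μ_v(x)²`) and ★ `coe_quotConj`.
[cite: Mok2014, §2.5] [cite: Rogawski1990, §12.2 (2) p. 174] -/
theorem semilocalComponent_mu_units_map_conjLocal (L : Type) [Field L] [NumberField L] [IsCMField L]
    (μ : Literature.NumberTheory.Automorphic.IdeleClassGroup L →ₜ* Circle) (hμ : IsConjugateSymplectic L μ)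
    (v : HeightOneSpectrum (𝓞 ↥(maximalRealSubfield L))) (x : (UnitaryGroup.LocalRing L v)ˣ) :
    (toHeckeCharacter L μ).semilocalComponent L v
        (Units.map (conjLocal L (IsCMField.complexConj L) v : UnitaryGroup.LocalRing L v →* UnitaryGroup.LocalRing L v) x) =
      ((toHeckeCharacter L μ).semilocalComponent L v x)⁻¹ := by
  have h := F0P2oStubDictTorusChar.semilocalComponent_mu_quotConj L μ hμ v x
  rw [coe_quotConj, map_mul, map_inv] at h
  rw [← mul_left_cancel h, inv_inv]

/-! ## §4 (D) The Weyl flip of `χθ^w` is `χθ` (the `χ₁`-coordinate; `χ₂ = ψθ` and `det` are `w`-fixed) -/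

/-- **`((χ₁θʷ) ∘ σ)⁻¹ = χ₁θ`** where `χ₁θʷ = (ψθ⁻¹ ∘ (a/ā)) · (μ_v · ‖·‖⁻¹) · ‖·‖^{1/2}` is the `χ₁`-coordinate of
`χθ^w = cmXiTorusChar L v (μ_v·(‖·‖^{1/2})⁻²) ψθ⁻¹ ψθ` and `χ₁θ = (ψθ⁻¹ ∘ (a/ā)) · μ_v · ‖·‖^{1/2}` that of `χθ = cmXiTorusChar L v μ_v ψθ⁻¹ ψθ`
(★ `xiTorusChar` := `torusCharPair … 0 χ₁ χ₂`, definitionally): print's `w(χ₁, χ₂) = (χ̄₁⁻¹, χ₂)` computed on `χθ^w` — by (A), (B), (C).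
[cite: Rogawski1990, §12.2 (2) p. 174] -/
theorem weylFlip_chiOne_thetaW (L : Type) [Field L] [NumberField L] [IsCMField L]
    (μ : Literature.NumberTheory.Automorphic.IdeleClassGroup L →ₜ* Circle) (hμ : IsConjugateSymplectic L μ)
    (v : HeightOneSpectrum (𝓞 ↥(maximalRealSubfield L)))
    (ψθ : ↥(normOneUnits (conjLocal L (IsCMField.complexConj L) v)) →* ℂˣ) :
    (((ψθ⁻¹).comp (quotConj (conjLocal L (IsCMField.complexConj L) v) (conjLocal_conjLocal_cm L v)) *
          ((toHeckeCharacter L μ).semilocalComponent L v * (halfModulusChar (UnitaryGroup.LocalRing L v) ^ 2)⁻¹) *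
          halfModulusChar (UnitaryGroup.LocalRing L v)).comp
        (Units.map (conjLocal L (IsCMField.complexConj L) v : UnitaryGroup.LocalRing L v →* UnitaryGroup.LocalRing L v)))⁻¹ =
      (ψθ⁻¹).comp (quotConj (conjLocal L (IsCMField.complexConj L) v) (conjLocal_conjLocal_cm L v)) *
        (toHeckeCharacter L μ).semilocalComponent L v * halfModulusChar (UnitaryGroup.LocalRing L v) := by
  refine MonoidHom.ext fun a => ?_
  simp only [MonoidHom.inv_apply, MonoidHom.comp_apply, MonoidHom.mul_apply, MonoidHom.pow_apply,
    quotConj_units_map, semilocalComponent_mu_units_map_conjLocal L μ hμ v a,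
    halfModulusChar_units_map_of_involutive _ (continuous_conjLocal L (IsCMField.complexConj L) v) (conjLocal_conjLocal_cm L v) a,
    map_inv, mul_inv_rev, inv_inv]
  -- `h · ((h²)⁻¹)⁻¹ ... ` : commutative-group bookkeeping in `ℂˣ`
  set h := halfModulusChar (UnitaryGroup.LocalRing L v) a
  set m := (toHeckeCharacter L μ).semilocalComponent L v a
  set q := ψθ (quotConj (conjLocal L (IsCMField.complexConj L) v) (conjLocal_conjLocal_cm L v) a)
  rw [sq, mul_assoc h h m, mul_assoc h (h * m) q⁻¹, inv_mul_cancel_left, mul_comm (h * m) q⁻¹, mul_comm h m, ← mul_assoc]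

/-! ## §5 The consumer: stub K1w of the K1 sub-skeleton, from the print letter BY NAME -/

set_option synthInstance.maxHeartbeats 400000 in
set_option maxHeartbeats 8000000 in
/-- **Stub K1w «WEYL SYMMETRY OF THE PRINCIPAL SERIES» of the K1 sub-skeleton `F0_P2GR91NJacquetK1` (v2, 35c8d923f732624c; statement
`StubK1wWeylSymmetric` VERBATIM), CLOSED MODULO the print letter ★ `Rogawski1990.cmPrincipalSeries_isConstituentOf_weylConj`** — a NAMED FACT
(`def … : Prop`, [Rogawski1990 §12.2 p. 174 L3–4; BernsteinZelevinsky1977 Thm. 2.9]) taken as the hypothesis `hW`, so this theorem is CONDITIONAL on it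
(the pay-down's declared residue).  Proof: the letter at `χ₁ := χ₁θʷ`, `χ₂ := ψθ` (`cmXiTorusChar … = torusCharPair … 0 χ₁ χ₂` definitionally) and the
Weyl flip `((χ₁θʷ) ∘ σ)⁻¹ = χ₁θ` (§4).  For a conjugate-symplectic `μ` the `w`-conjugate of `χθ^w = (μ_v‖·‖^{-1/2}, ψθ)` is `χθ = (μ_v‖·‖^{1/2}, ψθ)`, so a
constituent of `i_G(χθ^w)` is a constituent of `i_G(χθ)`. [cite: Rogawski1990, §12.1 p. 172, §12.2 (2) p. 174] [cite: BernsteinZelevinsky1977, Thm. 2.9] -/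
theorem stubK1w_of_weylConj (hW : Literature.NumberTheory.Rogawski1990.cmPrincipalSeries_isConstituentOf_weylConj) :

  ∀ (L : Type) [Field L] [NumberField L] [IsCMField L] (H : Matrix (Fin 3) (Fin 3) L) (hH : (H.map (cmConjRingHom L))ᵀ = H) (hHd : IsUnit H.det)
    {n' : ℕ} (e₁ : Fin 3 × Fin 1 ≃ Fin n') (dV : Fin 3 → L) (hdV : ∀ i, IsCMField.complexConj L (dV i) = dV i) (hdV0 : ∀ i, dV i ≠ 0) (g : GL (Fin 3) L)
    (hg : ((g : Matrix (Fin 3) (Fin 3) L).map (cmConjRingHom L))ᵀ * H * (g : Matrix (Fin 3) (Fin 3) L) = Matrix.diagonal dV),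
    ∀ (μ : Literature.NumberTheory.Automorphic.IdeleClassGroup L →ₜ* Circle) (hμ : IsConjugateSymplectic L μ)
      (χf : UnitaryGroup.finAdelicOne (↥(maximalRealSubfield L)) L (IsCMField.complexConj L) →* ℂˣ),
      Continuous χf → (∀ z, ‖((χf z : ℂˣ) : ℂ)‖ = 1) →
      ∀ (v : HeightOneSpectrum (𝓞 ↥(maximalRealSubfield L))),
        (∀ w : PlacesOver L v, IsCMField.complexConj L • w.1 = w.1) →
        ∀ (T : GL (Fin 3) (UnitaryGroup.LocalRing L v)) (a : UnitaryGroup.LocalRing L v) (ha : IsUnit a)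
          (h : formCongr (conjLocal L (IsCMField.complexConj L) v) T (H.map (algebraMap L (UnitaryGroup.LocalRing L v))) =
            a • (Matrix.of fun i j : Fin 3 => if i.val + j.val + 1 = 3 then (1 : L) else 0).map (algebraMap L (UnitaryGroup.LocalRing L v))),
          ∀ (ψθ : ↥(normOneUnits (conjLocal L (IsCMField.complexConj L) v)) →* ℂˣ) (c : IrrClass (Gqs L v)),
            c.IsConstituentOf (cmPrincipalSeries L 3 v (cmXiTorusChar L v ((toHeckeCharacter L μ).semilocalComponent L v * ((halfModulusChar (UnitaryGroup.LocalRing L v)) ^ 2)⁻¹) ψθ⁻¹ ψθ)) →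
            c.IsConstituentOf (cmPrincipalSeries L 3 v (cmXiTorusChar L v ((toHeckeCharacter L μ).semilocalComponent L v) ψθ⁻¹ ψθ)) := by
  intro L _ _ _ _ _ _ _ _ _ _ _ _ _ μ hμ _ _ _ v hv _ _ _ _ ψθ c hc
  have key := (hW L v hv
    ((ψθ⁻¹).comp (quotConj (conjLocal L (IsCMField.complexConj L) v) (conjLocal_conjLocal_cm L v)) *
      ((toHeckeCharacter L μ).semilocalComponent L v * (halfModulusChar (UnitaryGroup.LocalRing L v) ^ 2)⁻¹) *
      halfModulusChar (UnitaryGroup.LocalRing L v)) ψθ c).1 hc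
  rw [weylFlip_chiOne_thetaW L μ hμ v ψθ] at key
  exact key

end Summit.HodgeConjecture.HodgeConjecture.Cruxes.H413.F0P2oK1wOfWeylConj

end
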